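import Summits.QuantumFields.YangMills.Theorems.BalabanUVNodesN18CombStepAxialGauge
import Summits.QuantumFields.YangMills.Theorems.UnitScaleTiltProp7AxialGauge
import HarnessLib

/-!
# N18 (β)-transport letters: THE BASE CHANGE OF THE AXIAL GAUGE (`emb c₋` → `emb c₊`) ON THE COMB MEANS

[DAGN18W3-G5 INTENT-2, file (2a)] — count-neutral helper toward K3⁸ `stmt-QuantumFields-27366` (K3⁷ `stmt-QuantumFields-20544` aside; NOT claimed, NOT closed).
YM mass gap (Clay) NOT proved by any of this; R4 closes the conditional finite-𝕋⁴ rung `BalabanLadder.UV` only.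

WHY.  INTENT-1 ★★ `norm_potential_add_combGrad_le_axial` bounds `(iξ)⁻¹ log(Ū(𝐔)(c)Ū(U)(c)⁻¹) + (η∕ξ)(λ̄_{v₀}(c₊) − λ̄_{v₀}(c₋))` with BOTH comb means read in
the axial gauge `v₀ = axialT U (emb c₋)` of the bond's SOURCE block.  FILE 7's cancelled sum `|A′ − i∇^ξ_{U_A} l|` (G p619718 `hrest`) needs ONE comb generator
`l(y)` per coarse site: `l(y) = iη·m(y)`, `m(y) := λ̄_{Ad(axialT U (emb y))A′}(y)` — the comb mean in the axial gauge OF THE SITE's OWN block — and then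
`A′ − i∇^ξ_{U_A} l = [(iξ)⁻¹ log(ŪŪ_A⁻¹) + (η∕ξ)(λ̄_{v₀}(c₊) − λ̄_{v₀}(c₋))] + (η∕ξ)[Ū(U)(c)·m(c₊)·Ū(U)(c)⁻¹ − λ̄_{v₀}(c₊)]` since `λ̄_{v₀}(c₋) = m(c₋)` verbatim.
The second bracket is the BASE CHANGE: on `B(c₊)` the two axial gauges differ by the straight transporter `g = v₀(emb c₊)` up to a holonomy
`H_x = (U^{v₀})(Γ_{emb c₊, x})` of the source gauge along the target block's comb (`g·u₊(x) = H_x·v₀(x)` EXACTLY, UST `holT_gaugeActT`), `‖H_x − 1‖ ≤ |Γ|·t`;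
so `λ̄_{Ad(v₀)A′}(c₊)` and `g·m(c₊)·g⁻¹` differ by `≤ ℓ²·t·a` (second order); the sequel adds `Ū(U)(c) = Ū(U^{v₀})(c)·g`, `‖Ū(U^{v₀})(c) − 1‖ ≤ 17ℓt`.

WHAT (ns `YMDAG.N18.TransportOfRecord`; `ℓ = (d+2)L`, `t ≥ (ℓ∕2)α` the axial-gauge radius of INTENT-1).
* §1 `norm_holT_sub_one_le_length_mul` (global product bound on `U1`), `walkSum_units_conj`, `combMean_units_conj`, `norm_inv_conj_sub_le_of_U1`
  (`‖H⁻¹ZH − Z‖ ≤ 2‖H − 1‖‖Z‖`), `norm_conj_sub_le_of_near_one` (`‖EZE⁻¹ − Z‖ ≤ 4r‖Z‖`).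
* §2 `l1_rel_emb_le_of_blockOf` (`|x − emb y|₁ ≤ d(L−1)∕2` on `B(y)`), `agreeOn_pull_of_block`, `axialT_congr_of_block` (the block's own axial gauge reads only
  block bonds), `axialT_mul_eq_holT_gauge_mul` (`g·u₊(x) = H_x·v₀(x)`).
* §3 ★ `norm_combMean_sub_conj_combMean_le` (the base change of the comb means: `‖λ̄_{Ad v₀ A}(c₊) − g·m(c₊)·g⁻¹‖ ≤ ℓ²·t·a`).
What is NOT here (sequel `…CombStepC0Sum`): the C⁰ cancelled sum at `c` with the site-wise comb (this ★ + INTENT-1 ★★ + `Ū(U)(c) = Ū(U^{v₀})(c)·g`); then the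
record-level `hrest` tuple (tracelessness via the frame cut-off of `A′`, `δ₀ = (d+2)a`, crude `δ₁`, `s₁`), the C¹ letter.

0 `def`, 0 `sorry`.  References: T. Bałaban, CMP **98** (1985) 17–51 [Balaban1985Averaging] ((8)–(11) pp.18–19, pp.24–25, (62)–(63) p.28, (122)–(126) p.36);
CMP **109** (1987) [Balaban1987RG1] ((0.4) p.253, (1.10)–(1.13) p.262).
-/

noncomputable section

open scoped BigOperators Matrix.Norms.L2Operator
open NormedSpace

namespace YMDAG.N18.TransportOfRecord

open Complex (I)
open Literature.MathematicalPhysics.QuantumFieldTheory.Balaban1983to89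
open Literature.MathematicalPhysics.QuantumFieldTheory.Balaban1983to89.T4Continuum
open Literature.MathematicalPhysics.QuantumFieldTheory.Balaban1983to89.BlockAveraging
open Literature.MathematicalPhysics.QuantumFieldTheory.Balaban1983to89.BlockAveragingEMLLinearised (walkSum walkSum_nil walkSum_cons combMean combMean_def)
open Literature.MathematicalPhysics.QuantumFieldTheory.Balaban1983to89.B12RegularSpaces111 (expI gaugeU adJ plaq plaq_eq nabla)
open Literature.MathematicalPhysics.QuantumFieldTheory.Balaban1983to89.B12RegularSpaces111Mono (expI_zero)
open Literature.MathematicalPhysics.QuantumFieldTheory.Balaban1983to89.MatrixLog (mlog)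
open Literature.MathematicalPhysics.QuantumFieldTheory.Balaban1983to89.B7Prop1Explicit renaming Site → LSite
open Literature.MathematicalPhysics.QuantumFieldTheory.Balaban1983to89.B7Prop1Explicit (e e_apply l1 U1 mem_U1 hol hol_mem treeWord disp_treeWord
  norm_inv_sub_one_le)
open Literature.MathematicalPhysics.QuantumFieldTheory.Balaban1983to89.B7Prop1Local (InBox AgreeOn hol_treeWord_congr)
open Literature.MathematicalPhysics.QuantumFieldTheory.Balaban1983to89.B10Eq27TorusAxialLog (transl transl_apply transl_add_e transl_zero transl_rel pull
  pull_apply hol_pull_zero holT holT_nil holT_cons_true holT_cons_false rel rel_apply axialT axialT_self gaugeActT)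
open Literature.MathematicalPhysics.QuantumFieldTheory.Balaban1983to89.T4TermwiseBCH (norm_units_conj_le)
open Literature.MathematicalPhysics.QuantumFieldTheory.Balaban1983to89.Node00.W1 (avgUnits)
open Summit.QuantumFields.YangMills.Theorems.Prop8Chart (emlAvgU_congr₂ norm_emlAvgU_sub_one_sub_linAvg_le)
open Summit.QuantumFields.YangMills.Theorems.Prop7AxialGauge (holT_gaugeActT)
open YMDAG.N18.AvgPotential (combMean_congr_block combMean_sub')
open Literature.MathematicalPhysics.QuantumFieldTheory.Balaban1983to89.BlockAveragingSectionQsstar (eq_blockSite_blockEquiv)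

variable {P : Params} {j : ℕ}

/-! ## §1 Algebra: products near `1`, conjugation through the linear comb letters -/

section Algebra

variable {𝔸 : Type*} [NormedRing 𝔸] [NormOneClass 𝔸]

/-- **Global product bound**: if every bond variable is bi-contractive and within `t` of `1`, transport along any word is within `|w|·t` of `1`
(`‖gh − 1‖ ≤ ‖g − 1‖ + ‖h − 1‖` for `‖g‖ ≤ 1`; `‖u⁻¹ − 1‖ ≤ ‖u − 1‖` on `U1`). [cite: Balaban1985Averaging, (9) p.18 and (19)-(20) p.21] -/
theorem norm_holT_sub_one_le_length_mul {V : GaugeField P j 𝔸ˣ} (hV1 : ∀ b, V b ∈ U1 𝔸) {t : ℝ} (ht : 0 ≤ t)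
    (hV : ∀ b, ‖((V b : 𝔸ˣ) : 𝔸) - 1‖ ≤ t) : ∀ (w : List (Letter P.d)) (x : Site P j), ‖((holT V x w : 𝔸ˣ) : 𝔸) - 1‖ ≤ w.length * t
  | [], x => by simp
  | (μ, true) :: w, x => by
    rw [holT_cons_true, Units.val_mul, List.length_cons, Nat.cast_succ, add_mul, one_mul]
    have h1 : ‖((V ⟨x, μ⟩ : 𝔸ˣ) : 𝔸)‖ ≤ 1 := (mem_U1.mp (hV1 _)).1
    have h := B8Ineq170.norm_mul_sub_one_le_of_norm_le_one (b := ((holT V (x.shift μ) w : 𝔸ˣ) : 𝔸)) h1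
    have ih := norm_holT_sub_one_le_length_mul hV1 ht hV w (x.shift μ)
    linarith [hV ⟨x, μ⟩]
  | (μ, false) :: w, x => by
    rw [holT_cons_false, Units.val_mul, List.length_cons, Nat.cast_succ, add_mul, one_mul]
    have h1 : ‖(((V ⟨x.unshift μ, μ⟩)⁻¹ : 𝔸ˣ) : 𝔸)‖ ≤ 1 := (mem_U1.mp (hV1 _)).2
    have h := B8Ineq170.norm_mul_sub_one_le_of_norm_le_one (b := ((holT V (x.unshift μ) w : 𝔸ˣ) : 𝔸)) h1
    have h2 := norm_inv_sub_one_le (hV1 ⟨x.unshift μ, μ⟩)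
    have ih := norm_holT_sub_one_le_length_mul hV1 ht hV w (x.unshift μ)
    linarith [hV ⟨x.unshift μ, μ⟩]

omit [NormOneClass 𝔸] in
/-- `‖H⁻¹ZH − Z‖ ≤ 2‖H − 1‖·‖Z‖` for bi-contractive `H` (`H⁻¹ZH − Z = H⁻¹(Z(H − 1) − (H − 1)Z)`). [folklore] -/
theorem norm_inv_conj_sub_le_of_U1 [NormOneClass 𝔸] {H : 𝔸ˣ} (hH : H ∈ U1 𝔸) (Z : 𝔸) :
    ‖((H⁻¹ : 𝔸ˣ) : 𝔸) * Z * (H : 𝔸) - Z‖ ≤ 2 * ‖(H : 𝔸) - 1‖ * ‖Z‖ := by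
  have hid : ((H⁻¹ : 𝔸ˣ) : 𝔸) * Z * (H : 𝔸) - Z = ((H⁻¹ : 𝔸ˣ) : 𝔸) * (Z * ((H : 𝔸) - 1) - ((H : 𝔸) - 1) * Z) := by
    have h1 : Z * ((H : 𝔸) - 1) - ((H : 𝔸) - 1) * Z = Z * (H : 𝔸) - (H : 𝔸) * Z := by noncomm_ring
    rw [h1, mul_sub, ← mul_assoc, ← mul_assoc, Units.inv_mul, one_mul]
  rw [hid]
  have h1 : ‖((H⁻¹ : 𝔸ˣ) : 𝔸)‖ ≤ 1 := (mem_U1.mp hH).2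
  calc ‖((H⁻¹ : 𝔸ˣ) : 𝔸) * (Z * ((H : 𝔸) - 1) - ((H : 𝔸) - 1) * Z)‖
      ≤ ‖((H⁻¹ : 𝔸ˣ) : 𝔸)‖ * ‖Z * ((H : 𝔸) - 1) - ((H : 𝔸) - 1) * Z‖ := norm_mul_le _ _
    _ ≤ 1 * (‖Z‖ * ‖(H : 𝔸) - 1‖ + ‖(H : 𝔸) - 1‖ * ‖Z‖) :=
        mul_le_mul h1 ((norm_sub_le _ _).trans (add_le_add (norm_mul_le _ _) (norm_mul_le _ _))) (norm_nonneg _) zero_le_one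
    _ = 2 * ‖(H : 𝔸) - 1‖ * ‖Z‖ := by ring

omit [NormOneClass 𝔸] in
/-- `‖EZE⁻¹ − Z‖ ≤ 4r‖Z‖` for `‖E − 1‖ ≤ r ≤ 1∕2` (`EZE⁻¹ − Z = (E − 1)ZE⁻¹ + Z(E⁻¹ − 1)`, `‖E⁻¹‖ ≤ 2`, `‖E⁻¹ − 1‖ ≤ 2r`). [folklore] -/
theorem norm_conj_sub_le_of_near_one [CompleteSpace 𝔸] [NormOneClass 𝔸] {E : 𝔸ˣ} {r : ℝ} (hE : ‖(E : 𝔸) - 1‖ ≤ r) (hr : r ≤ 1 / 2) (Z : 𝔸) :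
    ‖(E : 𝔸) * Z * ((E⁻¹ : 𝔸ˣ) : 𝔸) - Z‖ ≤ 4 * r * ‖Z‖ := by
  obtain ⟨hi1, hi2⟩ := norm_units_inv_le_of_norm_sub_one_le hE hr
  have hr0 : 0 ≤ r := (norm_nonneg _).trans hE
  have hid : (E : 𝔸) * Z * ((E⁻¹ : 𝔸ˣ) : 𝔸) - Z = ((E : 𝔸) - 1) * Z * ((E⁻¹ : 𝔸ˣ) : 𝔸) + Z * (((E⁻¹ : 𝔸ˣ) : 𝔸) - 1) := by noncomm_ring
  rw [hid]
  calc ‖((E : 𝔸) - 1) * Z * ((E⁻¹ : 𝔸ˣ) : 𝔸) + Z * (((E⁻¹ : 𝔸ˣ) : 𝔸) - 1)‖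
      ≤ ‖(E : 𝔸) - 1‖ * ‖Z‖ * ‖((E⁻¹ : 𝔸ˣ) : 𝔸)‖ + ‖Z‖ * ‖((E⁻¹ : 𝔸ˣ) : 𝔸) - 1‖ :=
        (norm_add_le _ _).trans (add_le_add ((norm_mul_le _ _).trans (mul_le_mul_of_nonneg_right (norm_mul_le _ _) (norm_nonneg _))) (norm_mul_le _ _))
    _ ≤ r * ‖Z‖ * 2 + ‖Z‖ * (2 * r) := add_le_add (mul_le_mul (mul_le_mul_of_nonneg_right hE (norm_nonneg _)) hi1 (norm_nonneg _) (by positivity))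
        (mul_le_mul_of_nonneg_left hi2 (norm_nonneg _))
    _ = 4 * r * ‖Z‖ := by ring

omit [NormOneClass 𝔸] in
/-- Conjugation by a fixed unit passes through the signed walk sums. [cite: Balaban1984PropagatorsI, (1.8) p.19 (linearity)] -/
theorem walkSum_units_conj (g : 𝔸ˣ) (Y : PBond P j → 𝔸) :
    ∀ γ : List (LStep P j), walkSum (fun b => (g : 𝔸) * Y b * ((g⁻¹ : 𝔸ˣ) : 𝔸)) γ = (g : 𝔸) * walkSum Y γ * ((g⁻¹ : 𝔸ˣ) : 𝔸)
  | [] => by simp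
  | s :: γ => by
    rw [walkSum_cons, walkSum_cons, walkSum_units_conj g Y γ, mul_add, add_mul]
    split_ifs
    · rfl
    · rw [mul_neg, neg_mul]

end Algebra

section AlgebraMatrix

variable {n : Type*} [Fintype n] [DecidableEq n]

/-- Conjugation by a fixed unit passes through the comb mean `λ̄` (a mean of signed walk sums). [cite: Balaban1985Averaging, (62) p.28 (linearity)] -/
theorem combMean_units_conj (g : (Matrix n n ℂ)ˣ) (Y : PBond P j → Matrix n n ℂ) (y : Site P (j + 1)) :
    combMean (fun b => (g : Matrix n n ℂ) * Y b * ((g⁻¹ : (Matrix n n ℂ)ˣ) : Matrix n n ℂ)) y =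
      (g : Matrix n n ℂ) * combMean Y y * ((g⁻¹ : (Matrix n n ℂ)ˣ) : Matrix n n ℂ) := by
  rw [combMean_def, combMean_def]
  have hsum : ∑ i : Idx P, walkSum (fun b => (g : Matrix n n ℂ) * Y b * ((g⁻¹ : (Matrix n n ℂ)ˣ) : Matrix n n ℂ)) (walk (emb y) (stairWord i.2.1 (off i.1))) =
      (g : Matrix n n ℂ) * (∑ i : Idx P, walkSum Y (walk (emb y) (stairWord i.2.1 (off i.1)))) * ((g⁻¹ : (Matrix n n ℂ)ˣ) : Matrix n n ℂ) := by
    rw [Finset.mul_sum, Finset.sum_mul]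
    exact Finset.sum_congr rfl fun i _ => walkSum_units_conj g Y _
  rw [hsum, mul_smul_comm, smul_mul_assoc]

end AlgebraMatrix

/-! ## §2 Geometry of the base change: the target block's own comb versus the source gauge -/

section Geometry

/-- **A block site is within `ℓ¹`-distance `d(L−1)∕2` of its block centre.** [cite: Balaban1987RG1, (0.3) p.252] -/
theorem l1_rel_emb_le_of_blockOf (hj : j + 1 ≤ P.m + P.K) {y : Site P (j + 1)} {x : Site P j} (hx : blockOf x = y) :
    l1 (rel (emb y) x) ≤ P.d * ((P.L - 1) / 2) := by
  obtain ⟨r, hr⟩ : ∃ r : Fin P.d → Fin P.L, x = Site.blockSite (blockOf x) r := ⟨_, eq_blockSite_blockEquiv hj x⟩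
  rw [hx] at hr
  rw [hr, rel_emb_blockSite hj]
  unfold l1
  calc ∑ κ, (off r κ).natAbs ≤ ∑ _κ : Fin P.d, (P.L - 1) / 2 := Finset.sum_le_sum fun κ _ => by have := off_bounds r κ; omega
    _ = P.d * ((P.L - 1) / 2) := by rw [Finset.sum_const, Finset.card_univ, Fintype.card_fin, smul_eq_mul]

/-- Two fields agreeing on the bonds with both ends in `B(y)` have pullbacks (based at `emb y`) agreeing on the cube `[−h, h]ᵈ`. [cite: Balaban1987RG1, (0.3) p.252] -/
theorem agreeOn_pull_of_block {G : Type*} [Group G] (hj : j + 1 ≤ P.m + P.K) (y : Site P (j + 1)) {V V' : GaugeField P j G}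
    (h : ∀ b : PBond P j, blockOf b.src = y → blockOf b.tgt = y → V b = V' b) :
    AgreeOn (fun _ => -(((P.L - 1) / 2 : ℕ) : ℤ)) (fun _ => (((P.L - 1) / 2 : ℕ) : ℤ)) (pull V (emb y)) (pull V' (emb y)) := fun z κ hz hzκ => by
  rw [pull_apply, pull_apply]
  refine h _ (blockOf_eq_of_near_emb hj y _ z (fun ν => transl_apply _ _ ν) (fun ν => hz ν)) ?_
  rw [PBond.tgt, ← transl_add_e]
  exact blockOf_eq_of_near_emb hj y _ (z + e κ) (fun ν => transl_apply _ _ ν) (fun ν => hzκ ν)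

/-- **The block's own axial gauge reads only block bonds**: if `V = V′` on the bonds with both ends in `B(y)`, then `axialT V (emb y) x = axialT V′ (emb y) x`
on `B(y)` (the comb `Γ_{emb y, x}` stays in the cube). [cite: Balaban1985Averaging, p.24] -/
theorem axialT_congr_of_block {G : Type*} [Group G] (hj : j + 1 ≤ P.m + P.K) {y : Site P (j + 1)} {V V' : GaugeField P j G}
    (h : ∀ b : PBond P j, blockOf b.src = y → blockOf b.tgt = y → V b = V' b) {x : Site P j} (hx : blockOf x = y) :
    axialT V (emb y) x = axialT V' (emb y) x := by
  obtain ⟨r, hr⟩ : ∃ r : Fin P.d → Fin P.L, x = Site.blockSite (blockOf x) r := ⟨_, eq_blockSite_blockEquiv hj x⟩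
  rw [hx] at hr
  rw [axialT, axialT, ← hol_pull_zero, ← hol_pull_zero]
  have h0 : InBox (fun _ => -(((P.L - 1) / 2 : ℕ) : ℤ)) (fun _ => (((P.L - 1) / 2 : ℕ) : ℤ)) (0 : LSite P.d) :=
    fun ν => by simp only [Pi.zero_apply]; omega
  refine hol_treeWord_congr (agreeOn_pull_of_block hj y h) 0 _ h0 ?_
  rw [zero_add, hr, rel_emb_blockSite hj]
  exact fun ν => off_bounds r ν

/-- **`g·u₊(x) = H_x·v₀(x)`**: for ANY gauge transformation `v` of the fine torus, the comb holonomy of `U^{v}` from `emb y` to `x` is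
`H_x = v(emb y)·U(Γ_{emb y,x})·v(x)⁻¹ = v(emb y)·u_y(x)·v(x)⁻¹`, `u_y = axialT U (emb y)` (UST `holT_gaugeActT`). [cite: Balaban1985Averaging, (8) p.18, p.24] -/
theorem holT_gaugeU_treeWord_eq {𝔸 : Type*} [Ring 𝔸] (v : Site P j → 𝔸ˣ) (U : GaugeField P j 𝔸ˣ) (y : Site P (j + 1)) (x : Site P j) :
    holT (gaugeU v U) (emb y) (treeWord (rel (emb y) x)) = v (emb y) * axialT U (emb y) x * (v x)⁻¹ := by
  have h := holT_gaugeActT v U (emb y) (treeWord (rel (emb y) x))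
  rw [B10Eq27TorusAxialLog.transl_disp_treeWord_rel] at h
  exact h

end Geometry

/-! ## §3 The base change of the comb means and the C⁰ cancelled sum at one coarse bond -/

section BaseChange

variable {n : Type*} [Fintype n] [DecidableEq n] [Nonempty n]

/-- ★ **THE BASE CHANGE OF THE COMB MEANS.**  Let `c` be a coarse bond (`j + 2 ≤ m + K`), `U ∈ U1` on the two-block bonds with `‖∂U(p) − 1‖ ≤ α` on the
two-block plaquettes, `((d+2)L∕2)·α ≤ t`, `|A| ≤ a` on the bonds of `B(c₊)`.  With `v₀ = axialT U (emb c₋)` (source gauge), `u₊ = axialT U (emb c₊)`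
(target block's own gauge) and `g = v₀(emb c₊)`:  `‖λ̄_{Ad(v₀)A}(c₊) − g·λ̄_{Ad(u₊)A}(c₊)·g⁻¹‖ ≤ ℓ²·t·a`, `ℓ = (d+2)L`.
On `B(c₊)`, `v₀ = H⁻¹·g·u₊` with `H_x = U^{v₀}(Γ_{emb c₊,x})`, a product of `≤ d(L−1)∕2` axial-gauge bond variables each within `t` of `1` (INTENT-1 ★, read on
the field cut off after gauging), so `Ad(v₀)A − Ad(g u₊)A = H⁻¹ZH − Z`, `‖·‖ ≤ 2·(d(L−1)∕2)·t·a ≤ ℓta` bondwise, and `‖λ̄_Y‖ ≤ ℓ·sup|Y|`.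
[cite: Balaban1985Averaging, (8) p.18, pp.24-25, (62)-(63) p.28] -/
theorem norm_combMean_sub_conj_combMean_le (hj : j + 1 ≤ P.m + P.K) (hj2 : j + 2 ≤ P.m + P.K) (c : PBond P (j + 1))
    {U : GaugeField P j (Matrix n n ℂ)ˣ} {A : PBond P j → Matrix n n ℂ} {a α t : ℝ} (ha0 : 0 ≤ a) (hα : 0 ≤ α)
    (hA : ∀ b : PBond P j, blockOf b.src = c.tgt → blockOf b.tgt = c.tgt → ‖A b‖ ≤ a)
    (hU1 : ∀ b : PBond P j, (blockOf b.src = c.src ∨ blockOf b.src = c.tgt) → (blockOf b.tgt = c.src ∨ blockOf b.tgt = c.tgt) →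
      U b ∈ U1 (Matrix n n ℂ))
    (hplaq : ∀ p : Plaq P j, (blockOf p.src = c.src ∨ blockOf p.src = c.tgt) →
      (blockOf (p.src.shift p.μ) = c.src ∨ blockOf (p.src.shift p.μ) = c.tgt) →
      (blockOf (p.src.shift p.ν) = c.src ∨ blockOf (p.src.shift p.ν) = c.tgt) →
      (blockOf ((p.src.shift p.μ).shift p.ν) = c.src ∨ blockOf ((p.src.shift p.μ).shift p.ν) = c.tgt) →
      ‖((plaq U p : (Matrix n n ℂ)ˣ) : Matrix n n ℂ) - 1‖ ≤ α)
    (hRt : ((((P.d + 2) * P.L : ℕ) : ℝ) / 2) * α ≤ t) :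
    ‖combMean (adJ (axialT U (emb c.src)) A) c.tgt -
        ((axialT U (emb c.src) (emb c.tgt) : (Matrix n n ℂ)ˣ) : Matrix n n ℂ) * combMean (adJ (axialT U (emb c.tgt)) A) c.tgt *
          (((axialT U (emb c.src) (emb c.tgt))⁻¹ : (Matrix n n ℂ)ˣ) : Matrix n n ℂ)‖ ≤
      (((P.d + 2) * P.L : ℕ) : ℝ) ^ 2 * t * a := by
  classical
  have ht0 : 0 ≤ t := le_trans (by positivity) hRt
  set ℓ : ℝ := (((P.d + 2) * P.L : ℕ) : ℝ) with hℓ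
  have hℓ0 : 0 ≤ ℓ := Nat.cast_nonneg _
  -- the cut-off factor and the gauges
  let χ : PBond P j → Prop := fun b => (blockOf b.src = c.src ∨ blockOf b.src = c.tgt) ∧ (blockOf b.tgt = c.src ∨ blockOf b.tgt = c.tgt)
  let U' : GaugeField P j (Matrix n n ℂ)ˣ := fun b => if χ b then U b else 1
  have hU'U : ∀ b : PBond P j, (blockOf b.src = c.src ∨ blockOf b.src = c.tgt) → (blockOf b.tgt = c.src ∨ blockOf b.tgt = c.tgt) → U' b = U b :=
    fun b h1 h2 => by simp only [U', χ, if_pos (And.intro h1 h2)]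
  have hU'1 : ∀ b, U' b ∈ U1 (Matrix n n ℂ) := fun b => by
    by_cases hb : χ b
    · simp only [U', if_pos hb]; exact hU1 b hb.1 hb.2
    · simp only [U', if_neg hb]; exact (U1 _).one_mem
  have hplaq' : ∀ p : Plaq P j, (blockOf p.src = c.src ∨ blockOf p.src = c.tgt) →
      (blockOf (p.src.shift p.μ) = c.src ∨ blockOf (p.src.shift p.μ) = c.tgt) →
      (blockOf (p.src.shift p.ν) = c.src ∨ blockOf (p.src.shift p.ν) = c.tgt) →
      (blockOf ((p.src.shift p.μ).shift p.ν) = c.src ∨ blockOf ((p.src.shift p.μ).shift p.ν) = c.tgt) →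
      ‖((plaq U' p : (Matrix n n ℂ)ˣ) : Matrix n n ℂ) - 1‖ ≤ α := fun p c1 c2 c3 c4 => by
    have hpe : plaq U' p = plaq U p := by
      rw [plaq_eq, plaq_eq, hU'U ⟨p.src, p.μ⟩ c1 c2, hU'U ⟨p.src.shift p.μ, p.ν⟩ c2 c4, hU'U ⟨p.src, p.ν⟩ c1 c3,
        hU'U ⟨p.src.shift p.ν, p.μ⟩ c3 (by rw [PBond.tgt, Site.shift_comm]; exact c4)]
    rw [hpe]; exact hplaq p c1 c2 c3 c4
  set v₀ : Site P j → (Matrix n n ℂ)ˣ := axialT U (emb c.src) with hv₀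
  set v₀' : Site P j → (Matrix n n ℂ)ˣ := axialT U' (emb c.src) with hv₀'
  set u : Site P j → (Matrix n n ℂ)ˣ := axialT U (emb c.tgt) with hu
  have hvv' : ∀ x : Site P j, (blockOf x = c.src ∨ blockOf x = c.tgt) → v₀ x = v₀' x := fun x hx =>
    (axialT_congr_of_twoBlock hj hj2 c hU'U hx).symm
  have hv'1 : ∀ x, v₀' x ∈ U1 (Matrix n n ℂ) := fun x => axialT_mem_U1 hU'1 _ x
  have hctr : blockOf (emb c.tgt) = c.tgt := Site.blockOf_emb hj c.tgt
  set g : (Matrix n n ℂ)ˣ := v₀ (emb c.tgt) with hg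
  have hg1 : g ∈ U1 (Matrix n n ℂ) := by rw [hg, hvv' _ (Or.inr hctr)]; exact hv'1 _
  have hu1 : ∀ x : Site P j, blockOf x = c.tgt → u x ∈ U1 (Matrix n n ℂ) := fun x hx => by
    rw [hu, axialT_congr_of_block hj (fun b h1 h2 => (hU'U b (Or.inr h1) (Or.inr h2)).symm) hx]
    exact axialT_mem_U1 hU'1 _ x
  -- the source axial gauge cut off after gauging: globally `U1`, globally within `t` of `1`
  let W₀ : GaugeField P j (Matrix n n ℂ)ˣ := fun b => if χ b then gaugeU v₀' U' b else 1
  have hW₀1 : ∀ b, W₀ b ∈ U1 (Matrix n n ℂ) := fun b => by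
    by_cases hb : χ b
    · simp only [W₀, if_pos hb, gaugeU]
      exact (U1 _).mul_mem ((U1 _).mul_mem (hv'1 _) (hU'1 _)) ((U1 _).inv_mem (hv'1 _))
    · simp only [W₀, if_neg hb]; exact (U1 _).one_mem
  have hW₀t : ∀ b, ‖((W₀ b : (Matrix n n ℂ)ˣ) : Matrix n n ℂ) - 1‖ ≤ t := fun b => by
    by_cases hb : χ b
    · simp only [W₀, if_pos hb]
      exact (norm_gaugeU_axialT_sub_one_le_of_twoBlock hj hj2 hU'1 c hα hplaq' b hb.1 hb.2).trans hRt
    · simp only [W₀, if_neg hb, Units.val_one, sub_self, norm_zero]; exact ht0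
  -- `H_x`: the source-gauge holonomy along the target block's comb, `= g·u(x)·v₀(x)⁻¹`, within `(d(L−1)∕2)·t` of `1`
  have hH : ∀ x : Site P j, blockOf x = c.tgt →
      holT W₀ (emb c.tgt) (treeWord (rel (emb c.tgt) x)) = g * u x * (v₀ x)⁻¹ := fun x hx => by
    have hloc : holT W₀ (emb c.tgt) (treeWord (rel (emb c.tgt) x)) = holT (gaugeU v₀ U) (emb c.tgt) (treeWord (rel (emb c.tgt) x)) := by
      have := axialT_congr_of_block hj (V := W₀) (V' := gaugeU v₀ U) (fun b h1 h2 => ?_) hx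
      · simpa only [axialT] using this
      have hb : χ b := ⟨Or.inr h1, Or.inr h2⟩
      simp only [W₀, if_pos hb, gaugeU, hU'U b hb.1 hb.2, hvv' b.src hb.1, hvv' b.tgt hb.2]
    rw [hloc, holT_gaugeU_treeWord_eq]
  have hHt : ∀ x : Site P j, blockOf x = c.tgt → ‖((g * u x * (v₀ x)⁻¹ : (Matrix n n ℂ)ˣ) : Matrix n n ℂ) - 1‖ ≤ ℓ / 2 * t := fun x hx => by
    rw [← hH x hx]
    refine (norm_holT_sub_one_le_length_mul hW₀1 ht0 hW₀t _ _).trans ?_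
    rw [B7Prop1Explicit.length_treeWord]
    have hl : ((l1 (rel (emb c.tgt) x) : ℕ) : ℝ) ≤ ℓ / 2 := by
      have h1 := l1_rel_emb_le_of_blockOf hj hx
      have hL := AveragingRT.two_mul_half_add_one P
      have h2 : 2 * (P.d * ((P.L - 1) / 2)) ≤ (P.d + 2) * P.L := by nlinarith
      have h3 : (2 : ℝ) * ((l1 (rel (emb c.tgt) x) : ℕ) : ℝ) ≤ ℓ := by rw [hℓ]; exact_mod_cast (Nat.mul_le_mul_left 2 h1).trans h2
      linarith
    exact mul_le_mul_of_nonneg_right hl ht0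
  have hHU1 : ∀ x : Site P j, blockOf x = c.tgt → g * u x * (v₀ x)⁻¹ ∈ U1 (Matrix n n ℂ) := fun x hx =>
    (U1 _).mul_mem ((U1 _).mul_mem hg1 (hu1 x hx)) ((U1 _).inv_mem (by rw [hvv' x (Or.inr hx)]; exact hv'1 x))
  -- bondwise: `Ad(v₀)A(b) − g·Ad(u)A(b)·g⁻¹ = H⁻¹ Z H − Z`
  let Z : PBond P j → Matrix n n ℂ := fun b => (g : Matrix n n ℂ) * adJ u A b * ((g⁻¹ : (Matrix n n ℂ)ˣ) : Matrix n n ℂ)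
  let D : PBond P j → Matrix n n ℂ := fun b => if blockOf b.src = c.tgt ∧ blockOf b.tgt = c.tgt then adJ v₀ A b - Z b else 0
  have hD : ∀ b, ‖D b‖ ≤ ℓ * t * a := fun b => by
    by_cases hb : blockOf b.src = c.tgt ∧ blockOf b.tgt = c.tgt
    · simp only [D, if_pos hb]
      set H : (Matrix n n ℂ)ˣ := g * u b.src * (v₀ b.src)⁻¹ with hHdef
      have hvH : v₀ b.src = H⁻¹ * (g * u b.src) := by rw [hHdef]; group
      have hid : adJ v₀ A b - Z b = ((H⁻¹ : (Matrix n n ℂ)ˣ) : Matrix n n ℂ) * Z b * (H : Matrix n n ℂ) - Z b := by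
        simp only [Z, adJ, hvH, Units.val_mul, mul_inv_rev, inv_inv]
        noncomm_ring
      rw [hid]
      have hZ : ‖Z b‖ ≤ a := by
        simp only [Z]
        exact (norm_units_conj_le hg1 _).trans ((norm_units_conj_le (hu1 b.src hb.1) _).trans (hA b hb.1 hb.2))
      calc ‖((H⁻¹ : (Matrix n n ℂ)ˣ) : Matrix n n ℂ) * Z b * (H : Matrix n n ℂ) - Z b‖ ≤ 2 * ‖(H : Matrix n n ℂ) - 1‖ * ‖Z b‖ :=
            norm_inv_conj_sub_le_of_U1 (hHU1 b.src hb.1) _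
        _ ≤ 2 * (ℓ / 2 * t) * a := by
            have h1 := hHt b.src hb.1
            have : 0 ≤ ‖(H : Matrix n n ℂ) - 1‖ := norm_nonneg _
            nlinarith [norm_nonneg (Z b)]
        _ = ℓ * t * a := by ring
    · simp only [D, if_neg hb, norm_zero]; positivity
  -- the comb means
  have hdiff : combMean (adJ v₀ A) c.tgt - (g : Matrix n n ℂ) * combMean (adJ u A) c.tgt * ((g⁻¹ : (Matrix n n ℂ)ˣ) : Matrix n n ℂ) =
      combMean D c.tgt := by
    rw [← combMean_units_conj, ← combMean_sub']
    refine combMean_congr_block hj c.tgt fun b h1 h2 => ?_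
    simp only [D, Z, if_pos (And.intro h1 h2)]
  rw [hdiff]
  refine (norm_combMean_le_of_bound D (by positivity) hD c.tgt).trans (le_of_eq ?_)
  rw [hℓ]; ring

end BaseChange

end YMDAG.N18.TransportOfRecord

end
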